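import Mathlib.Algebra.BigOperators.Intervals
import Mathlib.Tactic
import Summits.CriticalPhenomena.PercolationContinuityZ3.Theorems.PercNearOneGluingNoHeavyLowerTailTwoBlockPeel
import HarnessLib

/-!
# Chain Cauchy–Binet: a kernel composition over a chain index is TP₂

Support file for the Sahi / Conjecture-P programme of route `PercNearOneGluingNoHeavy`
(`--supports stmt-CriticalPhenomena-4575`, prover prim-l12-p5 gen 25; proof note
`prim-l12-p5/THREE-RATE-g25.md` §1, Lemma 1.1 = the analytic core of THEOREM 3R: mixed
log-supermodularity `Zc(a+1,c+1) Zc(a,c) ≥ Zc(a+1,c) Zc(a,c+1)` of the two-block partition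
function of every THREE-RATE law `x_C = θ₀ + θ₁[C ∩ O₁ ≠ ∅] + θ₂[C ∩ O₂ ≠ ∅]`).
No definitions, no named facts, no sorries.

Setting (note §1): the coefficient array of `(1-x)^{-α} (1-y)^{-β} (1-w)^{-γ}`, `w = xy/((1-x)(1-y))`,
is `f(a,c) = ∑_r h_r A(a,r) B(c,r)` with `h_r ≥ 0` and kernels `A`, `B` that are TP₂ in
(row, chain index).  The present lemma is the abstract step: if `h ≥ 0` and, for the two rows
`a ≤ a'` (resp. `c ≤ c'`) under comparison, `A a' r · A a r' ≤ A a r · A a' r'` for `r ≤ r'`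
(resp. the same for `B`), then the 2 × 2 minor of `f` on rows `a, a'` and columns `c, c'` is
nonnegative.  Proof: expand the products of sums into a double sum, antisymmetrise it with
`TwoBlockPeel.sum_square_split`, and observe that each symmetrised term is a product of an
`A`-minor and a `B`-minor of the same sign.
-/

namespace Summit.CriticalPhenomena.PercolationContinuityZ3.Theorems

namespace ChainTP2

open Finset

variable (h : ℕ → ℝ) (A B : ℕ → ℕ → ℝ)

/-- Expansion of the 2 × 2 minor of the composition as a double sum of
`h r h r' B c r B c' r' (A a r A a' r' - A a' r A a r')`. -/
theorem minor_expand (N a a' c c' : ℕ) :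
    (∑ r ∈ range N, h r * A a r * B c r) * (∑ r ∈ range N, h r * A a' r * B c' r) -
      (∑ r ∈ range N, h r * A a' r * B c r) * (∑ r ∈ range N, h r * A a r * B c' r) =
    ∑ r ∈ range N, ∑ r' ∈ range N,
      h r * h r' * (B c r * B c' r') * (A a r * A a' r' - A a' r * A a r') := by
  rw [Finset.sum_mul_sum, Finset.sum_mul_sum, ← Finset.sum_sub_distrib]
  refine Finset.sum_congr rfl fun r _ => ?_
  rw [← Finset.sum_sub_distrib]
  refine Finset.sum_congr rfl fun r' _ => ?_
  ring

/-- **Chain Cauchy–Binet (Lemma 1.1 of the note).**  If `h ≥ 0` and the kernels `A`, `B` satisfy the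
TP₂ comparisons on the rows `a ≤ a'`, `c ≤ c'` along the chain index, then
`f a' c · f a c' ≤ f a c · f a' c'` for `f a c = ∑_{r<N} h r A a r B c r`. -/
theorem tp2_of_chain (N a a' c c' : ℕ) (hh : ∀ r, 0 ≤ h r)
    (hA : ∀ r r', r ≤ r' → A a' r * A a r' ≤ A a r * A a' r')
    (hB : ∀ r r', r ≤ r' → B c' r * B c r' ≤ B c r * B c' r') :
    (∑ r ∈ range N, h r * A a' r * B c r) * (∑ r ∈ range N, h r * A a r * B c' r) ≤
      (∑ r ∈ range N, h r * A a r * B c r) * (∑ r ∈ range N, h r * A a' r * B c' r) := by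
  rw [← sub_nonneg, minor_expand]
  rw [TwoBlockPeel.sum_square_split
    (fun r r' => h r * h r' * (B c r * B c' r') * (A a r * A a' r' - A a' r * A a r')) N]
  have hdiag : ∑ b ∈ range N,
      h b * h b * (B c b * B c' b) * (A a b * A a' b - A a' b * A a b) = 0 := by
    refine Finset.sum_eq_zero fun b _ => ?_
    ring
  rw [hdiag, zero_add]
  refine Finset.sum_nonneg fun b' _ => Finset.sum_nonneg fun b hb => ?_
  rw [Finset.mem_Ico] at hb
  have hle : b' ≤ b := by omega
  -- the symmetrised term factors as (A-minor) · (B-minor), both nonpositive for b' ≤ b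
  have key : h b * h b' * (B c b * B c' b') * (A a b * A a' b' - A a' b * A a b') +
      h b' * h b * (B c b' * B c' b) * (A a b' * A a' b - A a' b' * A a b) =
      h b * h b' * ((A a' b' * A a b - A a b' * A a' b) * (B c' b' * B c b - B c b' * B c' b)) := by
    ring
  rw [key]
  have hAm : A a' b' * A a b - A a b' * A a' b ≤ 0 := by linarith [hA b' b hle]
  have hBm : B c' b' * B c b - B c b' * B c' b ≤ 0 := by linarith [hB b' b hle]
  exact mul_nonneg (mul_nonneg (hh b) (hh b')) (mul_nonneg_of_nonpos_of_nonpos hAm hBm)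

end ChainTP2

end Summit.CriticalPhenomena.PercolationContinuityZ3.Theorems
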